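import Summits.Ventures.CertifiedArithmetic.LowPrec.GemmThetaLawGenCls
import Summits.Ventures.CertifiedArithmetic.LowPrec.GemmThetaLawGenSucc

/-!
# Letter-dependent symbolic θ-certificates: soundness of the pair table

HONEST FRAMING (venture CertifiedArithmetic / cell `pub-lowprec`, seat gemm, gen 12 → 13): certified
error envelopes and provably optimal rounding/accumulation schemes for low-precision formats under
stated cost models; every table by two implementations; no hardware or vendor claims.

Step (S3, last part) of the soundness chain for `GemmThetaLawGenDefs.lean` (cell HANDOFF decision
35; `code/gemm/thetalaw/GENDEFS-CONTRACT.md` §5): `pairOK_sound` — if the pair table of a level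
`levp ≠ Q` and sign holds, the level's coverage checks hold for every letter and the law's
vertex-successor check `succOK` holds, then from every state `R = sgn·(M + t')·u_{levp}` with EVEN
`t' ∈ [0, M]` (`t' = M` is the next level's vertex; `t' = 0` at the top) every letter `q₂` is either
absorbed or pays for a preceding free move: `0 < d₂` and `(2^{levExp levp} + γ₂)·βD ≤ βN·d₂`
(`γ₂ = R₂ - R - q₂`, `d₂ = |q₂| - γ₂`, `R₂ = rneZ m (R + q₂)`).  Ingredients: `pairEdgeOK_sound`
(one table entry), `mem_classesFor_even` (an even-residue main class is a pair-table class),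
`coverOK_sound`, `succOK_sound`, and the step algebra of `GemmThetaLawGenCls`.
-/

namespace Literature.ComputerArithmetic.FloatingPoint

namespace MiniFloat

namespace ThetaLaw

namespace LawData

variable (L : LawData)

open AForm

/-- READING ONE PAIR-TABLE ENTRY at a parameter of the class domain. [cell] -/
theorem pairEdgeOK_sound {d1 : ℤ} {c : GCls} (h : L.pairEdgeOK d1 c = true) :
    ∃ tg : TgtI, L.target c.dom ((L.vform c.lev c.g c.pi).add (const (c.sgn * c.q))) c.tc =
        some tg ∧
      (tg.W.sub ((L.vform c.lev c.g c.pi).add (const (c.sgn * c.q)))).b = 0 ∧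
      (tg.W.sub ((L.vform c.lev c.g c.pi).add (const (c.sgn * c.q)))).c = 0 ∧
      L.closureOK c.dom tg = true ∧
      ((tg.W.sub ((L.vform c.lev c.g c.pi).add (const (c.sgn * c.q)))).a * c.sgn = -c.q ∨
        (0 < |c.q| - (tg.W.sub ((L.vform c.lev c.g c.pi).add (const (c.sgn * c.q)))).a * c.sgn ∧
          (d1 + (tg.W.sub ((L.vform c.lev c.g c.pi).add (const (c.sgn * c.q)))).a * c.sgn) *
              L.betaD ≤
            L.betaN *
              (|c.q| - (tg.W.sub ((L.vform c.lev c.g c.pi).add (const (c.sgn * c.q)))).a *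
                c.sgn))) := by
  unfold pairEdgeOK at h
  simp only at h
  cases htg : L.target c.dom ((L.vform c.lev c.g c.pi).add (const (c.sgn * c.q))) c.tc with
  | none => rw [htg] at h; simp at h
  | some tg =>
    rw [htg] at h
    simp only at h
    by_cases hdl : (tg.W.sub ((L.vform c.lev c.g c.pi).add (const (c.sgn * c.q)))).b ≠ 0 ∨
        (tg.W.sub ((L.vform c.lev c.g c.pi).add (const (c.sgn * c.q)))).c ≠ 0
    · rw [if_pos hdl] at h; simp at h
    rw [if_neg hdl] at h
    simp only [not_or, not_not] at hdl
    simp only [Bool.and_eq_true, Bool.or_eq_true, decide_eq_true_eq] at h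
    exact ⟨tg, rfl, hdl.1, hdl.2, h.1, h.2⟩

/-- AN EVEN-RESIDUE MAIN CLASS IS A PAIR-TABLE CLASS (same record). [cell] -/
theorem mem_classesFor_even {lev : Lev} {sgn q : ℤ} {tfix : Option ℤ} {c : GCls}
    (h : c ∈ L.classesFor lev sgn q none tfix) (hpi : c.pi % 2 = 0) :
    c ∈ L.classesFor lev sgn q (some 0) tfix := by
  unfold classesFor at h ⊢
  simp only [List.mem_flatMap, List.mem_filterMap, List.mem_range] at h ⊢
  obtain ⟨tc, htc, pi, hpi', hc⟩ := h
  refine ⟨tc, htc, pi, hpi', ?_⟩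
  have hc' : (L.mkDom lev (sgn * q) tc (L.gOf lev tc) pi tfix).map
      (fun d => (⟨lev, sgn, q, tc, L.gOf lev tc, pi, d⟩ : GCls)) = some c := by
    revert hc
    split <;> intro hc <;> first | exact hc | simp at hc
  have hcpi : c.pi = pi := by
    cases hmk : L.mkDom lev (sgn * q) tc (L.gOf lev tc) pi tfix with
    | none => rw [hmk] at hc'; simp at hc'
    | some d => rw [hmk] at hc'; simp only [Option.map_some, Option.some.injEq] at hc'; rw [← hc']
  split
  · exact hc'
  · rename_i hne
    exact absurd (by simp only [decide_eq_true_eq]; omega) hne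

/-- The residue modulus `g` is even (`2`, or a power of two `≥ 2`). [cell] -/
theorem gOf_even (lev : Lev) (tc : TCode) : 2 ∣ L.gOf lev tc := by
  cases tc with
  | xpos => exact ⟨1, rfl⟩
  | xneg => exact ⟨1, rfl⟩
  | bin e =>
    simp only [gOf]
    obtain ⟨a, ha⟩ : ∃ a, L.unit lev = 2 ^ a := by
      cases lev with
      | Q => exact ⟨0, rfl⟩
      | bin j => exact ⟨j + 1, rfl⟩
      | top => exact ⟨L.J + 2, rfl⟩
    rw [ha]
    by_cases hle : a ≤ e + 1
    · rw [Nat.pow_div hle (by norm_num)]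
      rcases Nat.eq_zero_or_pos (e + 1 - a) with h0 | hpos
      · rw [h0]; decide
      · obtain ⟨k, hk⟩ := Nat.exists_eq_succ_of_ne_zero (by omega : e + 1 - a ≠ 0)
        have h2 : 2 ≤ 2 ^ (e + 1 - a) := by
          rw [hk, pow_succ]; have := Nat.one_le_two_pow (n := k); omega
        rw [max_eq_right h2, hk, pow_succ]
        exact Dvd.intro_left _ rfl
    · rw [Nat.div_eq_of_lt (Nat.pow_lt_pow_right (by norm_num) (by omega))]
      decide

/-- The step algebra: with a constant symbolic gain, the true result is `sgn·W` and the true gain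
is `dl.a·sgn`. [cell] -/
theorem step_algebra {m : ℕ} {K T : ℤ} {c : GCls} (hd : c.dom.mem K T) (hev : 2 ∣ K)
    (hM : (2 : ℤ) ^ m = L.M0 * K) (hs : c.sgn = 1 ∨ c.sgn = -1) {tg : TgtI}
    (htg : L.target c.dom ((L.vform c.lev c.g c.pi).add (const (c.sgn * c.q))) c.tc = some tg)
    (hb : (tg.W.sub ((L.vform c.lev c.g c.pi).add (const (c.sgn * c.q)))).b = 0)
    (hcf : (tg.W.sub ((L.vform c.lev c.g c.pi).add (const (c.sgn * c.q)))).c = 0) {V R : ℤ}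
    (hV : V = c.sgn * (L.vform c.lev c.g c.pi).eval K T) (hR : R = rneZ m (V + c.q)) :
    R = c.sgn * tg.W.eval K T ∧
      R - V - c.q = (tg.W.sub ((L.vform c.lev c.g c.pi).add (const (c.sgn * c.q)))).a * c.sgn := by
  have hs2 : c.sgn * c.sgn = 1 := by rcases hs with h1 | h1 <;> rw [h1] <;> norm_num
  have hW := L.target_rneZ hd hev hM htg
  have hn1 : ((L.vform c.lev c.g c.pi).add (const (c.sgn * c.q))).eval K T =
      (L.vform c.lev c.g c.pi).eval K T + c.sgn * c.q := by simp
  have hdl : tg.W.eval K T = (L.vform c.lev c.g c.pi).eval K T + c.sgn * c.q +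
      (tg.W.sub ((L.vform c.lev c.g c.pi).add (const (c.sgn * c.q)))).a := by
    have e : (tg.W.sub ((L.vform c.lev c.g c.pi).add (const (c.sgn * c.q)))).eval K T =
        (tg.W.sub ((L.vform c.lev c.g c.pi).add (const (c.sgn * c.q)))).a := by
      rw [show ∀ f : AForm, f.eval K T = f.a + f.b * K + f.c * T from fun f => rfl, hb, hcf]
      ring
    rw [eval_sub, hn1] at e
    linarith
  have hRW : R = c.sgn * tg.W.eval K T := by
    rw [hR, hV, ← hW, hn1]
    rcases hs with h1 | h1
    · rw [h1]; simp
    · rw [h1, show (-1 : ℤ) * (L.vform c.lev c.g c.pi).eval K T + c.q =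
          -((L.vform c.lev c.g c.pi).eval K T + -1 * c.q) by ring, rneZ_neg]
      ring
  refine ⟨hRW, ?_⟩
  rw [hRW, hV]
  linear_combination c.sgn * hdl + c.q * hs2

/-- SOUNDNESS OF THE PAIR TABLE (grid units; see the module docstring).  `levp = bin j'` with
`j' ≤ J` and even `t' ∈ [0, M₀K]`, or `levp = top` and `t' = 0`. [cell] -/
theorem pairOK_sound {m : ℕ} {K : ℤ} (hev : 2 ∣ K) (hM : (2 : ℤ) ^ m = L.M0 * K)
    (hK : L.K0 ≤ K) (hfix : L.fixed = true → K = L.K0) (hsucc : L.succOK = true)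
    {levp : Lev} {sgn : ℤ} (hs : sgn = 1 ∨ sgn = -1) (hpair : L.pairOK levp sgn = true)
    (hcov : ∀ q₂ ∈ L.lam, L.coverOK levp sgn q₂ = true)
    (hlevp : (∃ j, levp = Lev.bin j ∧ j ≤ L.J) ∨ levp = Lev.top) {t' : ℤ} (ht0 : 0 ≤ t')
    (htM : t' ≤ L.M0 * K) (hte : 2 ∣ t') (httop : levp = Lev.top → t' = 0) {R : ℤ}
    (hR : R = sgn * ((L.M0 * K + t') * (L.unit levp : ℤ))) {q₂ : ℤ} (hq : q₂ ∈ L.lam) {R₂ : ℤ}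
    (hR₂ : R₂ = rneZ m (R + q₂)) :
    R₂ = R ∨ (0 < |q₂| - (R₂ - R - q₂) ∧
      (2 ^ L.levExp levp + (R₂ - R - q₂)) * L.betaD ≤ L.betaN * (|q₂| - (R₂ - R - q₂))) := by
  -- the table, as a membership statement
  have htab : ∀ c₂ : GCls,
      (c₂ ∈ L.lam.flatMap fun q2 => L.classesFor levp sgn q2 (some 0) none) ∨
      (c₂ ∈ (match levp with
        | Lev.bin j => L.lam.flatMap fun q2 =>
            L.classesFor (if j < L.J then Lev.bin (j + 1) else Lev.top) sgn q2 none (some 0)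
        | _ => [])) → L.pairEdgeOK (2 ^ L.levExp levp) c₂ = true := by
    intro c₂ hc₂
    unfold pairOK at hpair
    simp only [List.all_eq_true, List.mem_append] at hpair
    exact hpair c₂ hc₂
  -- from a pair-table class containing the state, the conclusion
  have hfin : ∀ c₂ : GCls, L.pairEdgeOK (2 ^ L.levExp levp) c₂ = true → c₂.sgn = sgn → c₂.q = q₂ →
      ∀ T₂ : ℤ, c₂.dom.mem K T₂ →
        (L.vform c₂.lev c₂.g c₂.pi).eval K T₂ = (L.M0 * K + t') * (L.unit levp : ℤ) →
        R₂ = R ∨ (0 < |q₂| - (R₂ - R - q₂) ∧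
          (2 ^ L.levExp levp + (R₂ - R - q₂)) * L.betaD ≤ L.betaN * (|q₂| - (R₂ - R - q₂))) := by
    intro c₂ hpe hsg hq2 T₂ hd₂ hval
    obtain ⟨tg, htg, hb, hcf, -, halt⟩ := L.pairEdgeOK_sound hpe
    have hs' : c₂.sgn = 1 ∨ c₂.sgn = -1 := by rw [hsg]; exact hs
    have hV : R = c₂.sgn * (L.vform c₂.lev c₂.g c₂.pi).eval K T₂ := by rw [hR, hval, hsg]
    have hR' : R₂ = rneZ m (R + c₂.q) := by rw [hR₂, hq2]
    obtain ⟨-, hγ⟩ := L.step_algebra hd₂ hev hM hs' htg hb hcf hV hR'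
    rw [hq2] at hγ halt
    rcases halt with habs | ⟨hpos, hle⟩
    · left; rw [← hγ] at habs; linarith
    · right; rw [← hγ] at hpos hle; exact ⟨hpos, hle⟩
  -- parity: `g` is even, so an even `t' = gT₂ + π` has even `π`
  have hpar : ∀ c₂ : GCls, ∀ T₂ : ℤ, 2 ∣ c₂.g → (c₂.g : ℤ) * T₂ + c₂.pi = t' → c₂.pi % 2 = 0 := by
    intro c₂ T₂ hg hres
    obtain ⟨g', hg'⟩ := hg
    obtain ⟨t'', ht''⟩ := hte
    have e1 : (c₂.g : ℤ) * T₂ = 2 * ((g' : ℤ) * T₂) := by rw [hg']; push_cast; ring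
    have : (c₂.pi : ℤ) = 2 * (t'' - (g' : ℤ) * T₂) := by linarith
    omega
  rcases hlevp with ⟨j, rfl, hj⟩ | rfl
  · -- a binade: interior (`t' ≤ M - 1`, main classes of `bin j`) or boundary (next vertex)
    by_cases hint : t' ≤ L.M0 * K - 1
    · obtain ⟨c₂, hc₂, T₂, hd₂, hres⟩ := L.coverOK_sound (hcov q₂ hq) hK hfix (t := t')
        (by simp only [trange, eval, const, zero_mul, mul_zero, add_zero]; exact ht0)
        (by simp only [trange, eval, mul_zero, add_zero]; linarith) (fun h => by simp at h)
      obtain ⟨hl, hsg, hq2, hg, -, -⟩ := L.classesFor_mem hc₂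
      have hmem := L.mem_classesFor_even hc₂ (hpar c₂ T₂ (hg ▸ L.gOf_even _ _) hres)
      refine hfin c₂ (htab c₂ (Or.inl (List.mem_flatMap.2 ⟨q₂, hq, hmem⟩))) hsg hq2 T₂ hd₂ ?_
      rw [hl, L.vform_eval_bin, hres]; unfold unit; push_cast; ring
    · -- boundary: `t' = M₀K`, the vertex `t = 0` of the next level
      have htb : t' = L.M0 * K := by omega
      obtain ⟨c₂, hc₂, hd₂, hres⟩ := L.succOK_sound hsucc hj hs hq hK hfix
      obtain ⟨hl, hsg, hq2, -, -, -⟩ := L.classesFor_mem hc₂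
      refine hfin c₂ (htab c₂ (Or.inr (List.mem_flatMap.2 ⟨q₂, hq, hc₂⟩))) hsg hq2 0 hd₂ ?_
      simp only [mul_zero, zero_add] at hres
      rw [hl]
      by_cases hjJ : j < L.J
      · rw [if_pos hjJ, L.vform_eval_bin, htb]
        simp only [mul_zero, hres, add_zero]
        unfold unit; push_cast; ring
      · rw [if_neg hjJ, L.vform_eval_top, htb, show L.J = j by omega]
        simp only [mul_zero, hres, add_zero]
        unfold unit; push_cast; ring
  · -- the top: `t' = 0`, main classes of the top (even residue)
    have ht : t' = 0 := httop rfl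
    obtain ⟨c₂, hc₂, T₂, hd₂, hres⟩ := L.coverOK_sound (hcov q₂ hq) hK hfix (t := t')
      (by simp only [trange, eval, const, zero_mul, mul_zero, add_zero]; exact ht0)
      (by simp only [trange, eval, const, zero_mul, mul_zero, add_zero]; linarith) (fun _ => ht)
    obtain ⟨hl, hsg, hq2, hg, -, -⟩ := L.classesFor_mem hc₂
    have hmem := L.mem_classesFor_even hc₂ (hpar c₂ T₂ (hg ▸ L.gOf_even _ _) hres)
    refine hfin c₂ (htab c₂ (Or.inl (List.mem_flatMap.2 ⟨q₂, hq, hmem⟩))) hsg hq2 T₂ hd₂ ?_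
    rw [hl, L.vform_eval_top, hres]; unfold unit; push_cast; ring

end LawData

end ThetaLaw

end MiniFloat

end Literature.ComputerArithmetic.FloatingPoint
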